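import Summits.QuantumFields.YangMills.Theorems.BalabanUVNodesN15KingModelFullPropagatorOperatorHolder

/-!
# BalabanUVNodes ∕ N15 — THE KING-MODEL RUNG, CURVED EDITION (PART T-d): KING'S THEOREM 3.3 (3.8) ∕ [Ba 4] (1.10) HÖLDER CLAUSE FOR THE FULL
# `A = 0` PROPAGATOR, WITH THE DECAY FROM THE SUPPORT — `|(A₀⁻¹f)(x′) − (A₀⁻¹f)(x)| ≤ C·(|x − x′|∕N)·e^{−δ₀·dist(B(x), supp f)}·‖f‖_∞` for
# `|x − x′| ≤ N` (the two points a unit cube apart at most), UNIFORMLY in `K`, the volume, the mass and the source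
# (Track A, DAG node N15 = NE2; FAN-OUT v1.1 §N15 s3 «KING-MODEL RUNG … + the one-line statement of what the curved case adds»)

HONEST FRAMING.  Count-neutral kernel bookkeeping (cell `pub-ymgap`, seat `pub-ymgap-dag-n15-e` g8; `--supports stmt-QuantumFields-20296
--as helper` = K3⁵ `SpineGivenEndpointR13SepCoP`, WORDS-141).  TEMPLATE LITERATURE, `A = 0`: [King1986] Theorem 3.3 (3.8) p. 656, verbatim
«`(1∕|x − y|^α)|U(A(Γ_{y,x}))D^η_{A,μ}G_k(Ω, A)f(x) − D^η_{A,μ}G_k(Ω, A)f(y)| ≤ C exp[−δ₀ dist({x, y}, supp f)] ‖f‖`» («proved in [Ba 4]» =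
[Balaban1983RegularityDecay] Theorem (1.10) p. 573); at `A = 0` the transport `U(A(Γ))` is `1`.  THIS FILE proves the `A = 0` Hölder clause for the
FUNCTION `A₀⁻¹f` itself (exponent `α = 1`, hence every `α ≤ 1`) with the printed decay from the support, on Bałaban's tori — a SHAPE consequence
of (1.10) clause 2 (K-lit `fineOp_inv_deriv_mulVec_decay_unif`) summed along part T-a's torus walk; the DERIVATIVE's Hölder clause ((3.8) proper,
(1.10) clause 3) needs second differences and is NOT claimed.  NOT Bałaban's `G(U)`; NE2⁺ NOT PRINTED and not proved here; NOT a node discharge;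
nothing continuum ∕ ℝ⁴ ∕ OS ∕ mass-gap ∕ Clay.  0 `sorry`, 0 `def`, standard axioms.

THE POINT.  Part T-c (`fullPropOp_lipschitz_unif`) summed the plain one-step bound; THIS FILE sums the one-step bound WITH DECAY
(`fineOp_inv_deriv_mulVec_decay_unif`: `|N·((A₀⁻¹f)(w + e_μ) − (A₀⁻¹f)(w))| ≤ c₀e^{−δ₀D}‖f‖_∞` whenever every block of `supp f` is `≥ D` blocks from
`B(w)`): along the walk from `x` to `x′` with `|x − x′| ≤ N` every point `w` is within fine distance `N` of `x`, so `|B(x) − B(w)| ≤ 1`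
(`blockDist_le_one_of_near`: part O-a `mul_tdistT_blockOf_le` + integrality of the block distance) and the support stays `≥ D − 1` blocks away:
* `blockDist_le_one_of_near`, ★★ **`fullPropOp_lipschitz_decay_unif`** — `∃ C, δ₀ > 0 ∀ K ≥ 1 ∀ M = sitesPerDir ∀ 0 ≤ m² ≤ m₀² ∀ f, |f| ≤ F ∀ D ∀ x x′`,
  `|x − x′| ≤ N`, `(∀ y, f y ≠ 0 → D ≤ |B(x) − B(y)|_M)`:  `|(A₀⁻¹f)(x′) − (A₀⁻¹f)(x)| ≤ C·(|x − x′|∕N)·e^{−δ₀D}·F`;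
  ★ `fullPropOp_holder_decay_unif` (`0 < α ≤ 1`: `≤ C·(|x − x′|∕N)^α·e^{−δ₀D}·F` — Theorem 3.3 (3.8)'s display for `G_k f` at `A = 0`, every `α ≤ 1`).
WHAT THE CURVED CASE ADDS (one line): the transport `U(A(Γ_{y,x}))`, `α < 1`, and the DERIVATIVE `D^η_{A,μ}G_k f` in place of `G_kf` — [Ba 4]'s
covariant statement; its η-difference version is not printed.
HONEST SCOPE.  (i) `A = 0`, periodic b.c., Bałaban's volumes, odd `L > 1`, `K ≥ 1`, `0 ≤ m² ≤ m₀²`; (ii) King's spelling of `A₀`; (iii) `|x − x′| ≤ N` (one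
unit cube's worth; for farther pairs iterate or use the sup bound); (iv) the function, not its derivative; (v) not Bałaban's `G(U)`; not a discharge.
Locators: [King1986] Theorem 3.3 (3.7)–(3.8) p. 656, (3.62) p. 663; [Balaban1983RegularityDecay] Theorem (1.10) p. 573; [Balaban1985BackgroundPropagators]
Thm 3.1 (3.43) p. 397.
-/

noncomputable section

namespace Summit.QuantumFields.YangMills.BalabanUVNodes.N15KingModelRung.Curved

open Real Finset Matrix
open Literature.MathematicalPhysics.QuantumFieldTheory.Balaban1983to89 (Params)
open Literature.MathematicalPhysics.QuantumFieldTheory.Balaban1983to89.B5Prop11Plancherel (Tor fine unitVec)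
open Literature.MathematicalPhysics.QuantumFieldTheory.King1986 (aK aK_pos)
open Literature.MathematicalPhysics.QuantumFieldTheory.King1986.Torus (fineOp blockOf tdistT toSite tdistT_nonneg tdistT_triangle
  fineOp_inv_deriv_mulVec_decay_unif exists_eq_site mul_tdistT_blocks_le)

/-- **Points within one block-length are in the same or adjacent blocks**: `|x − w|_{fine N M} ≤ N ⇒ |B(x) − B(w)|_M ≤ 1` — part O-a
`mul_tdistT_blockOf_le` ∕ K-lit `mul_tdistT_blocks_le` (`N·|B(x) − B(w)| ≤ |x − w| + N − 1 < 2N`) and the integrality of the torus distance. [folklore] -/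
theorem blockDist_le_one_of_near {dd : ℕ} (N : ℕ) [NeZero N] (M : Fin dd → ℕ) [∀ μ, NeZero (M μ)] (x w : Tor (fine N M))
    (h : tdistT (fine N M) x w ≤ N) : tdistT M (blockOf N M x) (blockOf N M w) ≤ 1 := by
  have hN1 : (1 : ℝ) ≤ N := by exact_mod_cast Nat.one_le_iff_ne_zero.mpr (NeZero.ne N)
  obtain ⟨j, hj⟩ := exists_eq_site N M x
  obtain ⟨j', hj'⟩ := exists_eq_site N M w
  have hmul := mul_tdistT_blocks_le N M (blockOf N M x) (blockOf N M w) j j'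
  rw [← hj, ← hj'] at hmul
  -- the block distance is a natural number `< 2`
  obtain ⟨t, ht⟩ : ∃ t : ℕ, tdistT M (blockOf N M x) (blockOf N M w) = (t : ℝ) := ⟨_, rfl⟩
  rw [ht] at hmul ⊢
  have hN0 : (0 : ℝ) < N := by linarith
  have hlt : (t : ℝ) < 2 := by
    have h2 : (N : ℝ) * t < N * 2 := by linarith
    exact lt_of_mul_lt_mul_left h2 hN0.le
  have ht1 : t ≤ 1 := by
    have : t < 2 := by exact_mod_cast hlt
    omega
  exact_mod_cast ht1

/-- **THEOREM 3.3 (3.8) ∕ (1.10) HÖLDER CLAUSE AT `A = 0`, `α = 1`, WITH THE DECAY FROM THE SUPPORT**: for `d + 1 ≥ 1` dimensions, odd `L > 1`, `a > 0`,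
`m₀² ≥ 0` there are `C, δ₀ > 0` such that for EVERY `K ≥ 1` (`M = sitesPerDir`, `N = L^K`), every mass `0 ≤ m² ≤ m₀²`, every source `|f| ≤ F`, every
`D` with `D ≤ |B(x) − B(y)|_M` for all `y ∈ supp f`, and all fine `x, x′` with `|x − x′| ≤ N`:
`|(A₀⁻¹f)(x′) − (A₀⁻¹f)(x)| ≤ C·(|x − x′|∕N)·e^{−δ₀D}·F` — King's «`C exp[−δ₀ dist({x, y}, supp f)] ‖f‖`» for the Hölder quotient of `G_kf` at `A = 0`
(distance in blocks from `B(x)`; the walk's points are `≤ 1` block from `B(x)`), uniformly in `K`, the volume, the mass and the source.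
[cite: King1986, Theorem 3.3 (3.8) p.656, (3.62) p.663; Balaban1983RegularityDecay, Theorem (1.10) p.573] -/
theorem fullPropOp_lipschitz_decay_unif (d L : ℕ) (hL : Odd L ∧ 1 < L) {a : ℝ} (ha : 0 < a) {m0sq : ℝ} (hm0 : 0 ≤ m0sq) :
    ∃ C δ₀ : ℝ, 0 < C ∧ 0 < δ₀ ∧ ∀ (P : Params), P.d = d + 1 → P.L = L → 1 ≤ P.K →
      ∀ (msq : ℝ), 0 ≤ msq → msq ≤ m0sq →
      ∀ (M : Fin P.d → ℕ) [∀ μ, NeZero (M μ)] (_hMK : ∀ μ, M μ = P.sitesPerDir P.K)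
        (N : ℕ) [NeZero N] (_hN : N = P.L ^ P.K) (f : Tor (fine N M) → ℝ) (F D : ℝ), (∀ y, |f y| ≤ F) →
        ∀ x x' : Tor (fine N M), tdistT (fine N M) x x' ≤ N →
        (∀ yt, f yt ≠ 0 → D ≤ tdistT M (blockOf N M x) (blockOf N M yt)) →
        |((fineOp N M (aK a P.L P.K) (((N : ℕ) : ℝ) ^ 2) msq)⁻¹ *ᵥ f) x'
            - ((fineOp N M (aK a P.L P.K) (((N : ℕ) : ℝ) ^ 2) msq)⁻¹ *ᵥ f) x|
          ≤ C * (tdistT (fine N M) x x' / N) * Real.exp (-(δ₀ * D)) * F := by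
  obtain ⟨δ₀, c₀, hδ₀, hc₀, H⟩ := fineOp_inv_deriv_mulVec_decay_unif (d + 1) L (Nat.succ_pos d) hL ha hm0
  refine ⟨((d + 1 : ℕ) : ℝ) * c₀ * Real.exp δ₀, δ₀, by positivity, hδ₀, ?_⟩
  intro P hPd hPL hK msq hmsq hcap M _ hMK N _ hN f F D hF x x' hcube hsupp
  have hN0 : (0 : ℝ) < N := by
    rw [hN]
    exact_mod_cast pow_pos (by rw [hPL]; omega) P.K
  have hF0 : 0 ≤ F := (abs_nonneg (f x)).trans (hF x)
  set g : Tor (fine N M) → ℝ := fun w => ((fineOp N M (aK a P.L P.K) (((N : ℕ) : ℝ) ^ 2) msq)⁻¹ *ᵥ f) w with hgdef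
  -- on the walk: `|B(x) − B(w)| ≤ 1`, so the support is `≥ D − 1` blocks from `B(w)`
  set B : ℝ := c₀ * Real.exp (-(δ₀ * (D - 1))) * F / N with hBdef
  have hB0 : 0 ≤ B := by positivity
  have hstep : ∀ w : Tor (fine N M), tdistT (fine N M) x w ≤ tdistT (fine N M) x x' → ∀ μ : Fin P.d,
      tdistT (fine N M) x (w + unitVec (fine N M) μ) ≤ tdistT (fine N M) x x' → |g (w + unitVec (fine N M) μ) - g w| ≤ B := by
    intro w hw μ _
    have hnear : tdistT (fine N M) x w ≤ N := hw.trans hcube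
    have hblk : tdistT M (blockOf N M x) (blockOf N M w) ≤ 1 := blockDist_le_one_of_near N M x w hnear
    have hsupp' : ∀ yt, f yt ≠ 0 → D - 1 ≤ tdistT M (blockOf N M w) (blockOf N M yt) := by
      intro yt hyt
      have h1 := hsupp yt hyt
      have htri := tdistT_triangle M (blockOf N M x) (blockOf N M w) (blockOf N M yt)
      linarith
    have h := H P hPd hPL hK msq hmsq hcap M hMK N hN f F (D - 1) hF w hsupp' μ
    rw [abs_mul, abs_of_pos hN0] at h
    rw [hBdef, le_div_iff₀ hN0, mul_comm]
    exact h
  have hwalk := abs_sub_le_of_ball_steps (fine N M) g x x' hB0 hstep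
  have hdd : ((P.d : ℕ) : ℝ) = ((d + 1 : ℕ) : ℝ) := by rw [hPd]
  have hexp : Real.exp (-(δ₀ * (D - 1))) = Real.exp δ₀ * Real.exp (-(δ₀ * D)) := by
    rw [← Real.exp_add]; congr 1; ring
  calc |g x' - g x| ≤ (P.d : ℝ) * tdistT (fine N M) x x' * B := hwalk
    _ = ((d + 1 : ℕ) : ℝ) * c₀ * Real.exp δ₀ * (tdistT (fine N M) x x' / N) * Real.exp (-(δ₀ * D)) * F := by
        rw [hdd, hBdef, hexp]; ring

/-- **THEOREM 3.3 (3.8)'s DISPLAY FOR `G_kf` AT `A = 0`, EVERY ORDER `0 < α ≤ 1`**: under the same data, `|(A₀⁻¹f)(x′) − (A₀⁻¹f)(x)| ≤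
C·(|x − x′|∕N)^α·e^{−δ₀D}·F` — «`(1∕|x − y|^α)|G_kf(x) − G_kf(y)| ≤ Ce^{−δ₀dist({x,y}, supp f)}‖f‖`» (`|x − x′|∕N ≤ 1`, so the exponent only helps).
[cite: King1986, Theorem 3.3 (3.8) p.656, (3.62) p.663; Balaban1983RegularityDecay, Theorem (1.10) p.573; Balaban1985BackgroundPropagators, Thm 3.1 (3.43) p.397] -/
theorem fullPropOp_holder_decay_unif (d L : ℕ) (hL : Odd L ∧ 1 < L) {a : ℝ} (ha : 0 < a) {m0sq : ℝ} (hm0 : 0 ≤ m0sq)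
    {α : ℝ} (hα0 : 0 < α) (hα1 : α ≤ 1) :
    ∃ C δ₀ : ℝ, 0 < C ∧ 0 < δ₀ ∧ ∀ (P : Params), P.d = d + 1 → P.L = L → 1 ≤ P.K →
      ∀ (msq : ℝ), 0 ≤ msq → msq ≤ m0sq →
      ∀ (M : Fin P.d → ℕ) [∀ μ, NeZero (M μ)] (_hMK : ∀ μ, M μ = P.sitesPerDir P.K)
        (N : ℕ) [NeZero N] (_hN : N = P.L ^ P.K) (f : Tor (fine N M) → ℝ) (F D : ℝ), (∀ y, |f y| ≤ F) →
        ∀ x x' : Tor (fine N M), tdistT (fine N M) x x' ≤ N →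
        (∀ yt, f yt ≠ 0 → D ≤ tdistT M (blockOf N M x) (blockOf N M yt)) →
        |((fineOp N M (aK a P.L P.K) (((N : ℕ) : ℝ) ^ 2) msq)⁻¹ *ᵥ f) x'
            - ((fineOp N M (aK a P.L P.K) (((N : ℕ) : ℝ) ^ 2) msq)⁻¹ *ᵥ f) x|
          ≤ C * (tdistT (fine N M) x x' / N) ^ α * Real.exp (-(δ₀ * D)) * F := by
  obtain ⟨C, δ₀, hC, hδ₀, H⟩ := fullPropOp_lipschitz_decay_unif d L hL ha hm0
  refine ⟨C, δ₀, hC, hδ₀, ?_⟩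
  intro P hPd hPL hK msq hmsq hcap M _ hMK N _ hN f F D hF x x' hcube hsupp
  have h := H P hPd hPL hK msq hmsq hcap M hMK N hN f F D hF x x' hcube hsupp
  have hN0 : (0 : ℝ) < N := by
    rw [hN]
    exact_mod_cast pow_pos (by rw [hPL]; omega) P.K
  have hF0 : 0 ≤ F := (abs_nonneg (f x)).trans (hF x)
  set q : ℝ := tdistT (fine N M) x x' / N with hqdef
  have hq0 : 0 ≤ q := div_nonneg (tdistT_nonneg _ x x') hN0.le
  have hq1 : q ≤ 1 := by rw [hqdef, div_le_one hN0]; exact hcube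
  have hqα : q ≤ q ^ α := by
    rcases hq0.eq_or_lt with h0 | hpos
    · rw [← h0, Real.zero_rpow hα0.ne']
    · calc q = q ^ (1 : ℝ) := (Real.rpow_one q).symm
        _ ≤ q ^ α := Real.rpow_le_rpow_of_exponent_ge hpos hq1 hα1
  have hE : 0 ≤ Real.exp (-(δ₀ * D)) := (Real.exp_pos _).le
  calc _ ≤ C * q * Real.exp (-(δ₀ * D)) * F := h
    _ ≤ C * q ^ α * Real.exp (-(δ₀ * D)) * F :=
        mul_le_mul_of_nonneg_right (mul_le_mul_of_nonneg_right (mul_le_mul_of_nonneg_left hqα hC.le) hE) hF0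

end Summit.QuantumFields.YangMills.BalabanUVNodes.N15KingModelRung.Curved
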